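import Summits.HubbardSuperconductivity.HubbardSuperconductivity.Theses.AbelianDuality
import Literature.MathematicalPhysics.QuantumLattice.HubbardTorusFlux
import HarnessLib

/-!
# Crux `Thesis` (stmt-HubbardSuperconductivity-1634), line `birth` — BC3 birth skeleton

Route `AbelianDuality` (route-HubbardSuperconductivity-AbelianDuality), hub crux `Thesis` (rank 0,
auto-crux): SECTOR-GROUND-STATE-AVERAGE `d_{x²-y²}` PAIR LRO ON A COUPLING WINDOW —
`∃ δ ∈ (0,1/2), 0 < U₁ < U₂, c > 0, L₀, ∀ U ∈ (U₁,U₂), ∀ even L ≥ L₀: c·L⁴ ≤ Re ω₀^{sec}_{U,L}(Δ_d†Δ_d)`,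
`ω₀^{sec}` = `Matrix.groundStateFunctional` of `hubbardTorus 2 L 1 U` compressed (`Matrix.toBlock p p`)
to the `(N_L, S^z = 0)` coordinate sector, `N_L = 2⌊(1-δ)L²/2⌋`, `Δ_d = pairField dWaveFormFactor L`.
The crux is open physics (the superconducting window of the pure `t' = 0` Hubbard model) and is NOT
settled here; this file only registers a typed line of attack with named stubs.

## The line = the route's T = 0 engine cut at its two dictionary entries, plus channel selection

The route's dictionary (header, WHY THIS LINE): pair phase ↦ XY angle, pair current ↦ J-current,
vortex ↦ dual defect LOOP (effective dimension 2+1), PHASE STIFFNESS ↦ VILLAIN β. Its T = 0 line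
("reduction to a positive (2+1)D current model in the dilute-vortex class + Peierls on vortex loops
⇒ Thesis") is informal until `PositiveCurrentModel` lands (item 1786). The present skeleton types the
same line through the one stiffness object the tree already has — the Byers–Yang /
Scalapino–White–Zhang FLUX ENVELOPE `fluxEnergy L U δ θ` (lowest energy of the seam-twisted torus
`hubbardTorusFlux L U θ` in the `(N_L, S^z = 0)` sector; `Literature/…/HubbardTorusFlux.lean`, all API
proved) — and isolates the Hubbard-specific channel question in a third stub:

* **(S1) `stub_groundStateStiffness` — GROUND-STATE PAIR STIFFNESS ON A WINDOW (the engine's large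
  parameter, "phase stiffness ↦ Villain β").** `∃ δ ∈ (0,1/4), 0 < U₁ < U₂, ρ > 0, L₀` such that for
  all `U ∈ (U₁,U₂)`, even `L ≥ L₀` and `|θ| ≤ π/2` (up to half a PAIR flux quantum):
  `ρ θ² ≤ fluxEnergy L U δ θ - fluxEnergy L U δ 0`.
  This is the `d = 2` scale-invariant helicity modulus of the sector ground state read off the SWZ
  envelope (superfluid weight `D_s > 0`, not the Drude weight: a metal's envelope is flat or dips by
  level crossings of current-carrying open shells; a charge-`4e` condensate returns to `E(0)` at
  `θ = π/2`), uniform on an open `U`-window as the every-ground-state upgrade `AverageToEvery` of the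
  route demands. OPEN: it is the Meissner stiffness of the pure repulsive Hubbard model; weak coupling
  only sets in for `L ≫ ξ ∼ e^{C/U²}` (barrier `WeakCouplingCeiling`, shared bet of the route); at
  `U ≈ 8, δ ≈ 1/8` stripes win (Qin et al. 2020). Calibrated from above by the PROVED Bloch bound
  `E(θ) ≤ E(0) + 2θ²` (FluxSpectroscopy.BlochBound, so necessarily `ρ ≤ 2`).
* **(S2) `stub_stiffnessToBondCondensation` — THE ABELIAN ENGINE AT T = 0 (stiffness ⇒ condensation
  in effective dimension 2+1).** For all data `δ ∈ (0,1/4)`, `0 < U₁ < U₂`, `ρ > 0`, `L₀`: the body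
  of S1 forces, on some OPEN SUB-WINDOW `U₁ ≤ U₁' < U₂' ≤ U₂` (room to step off quantum phase
  transitions inside the window, where the order constant degenerates while the stiffness need not),
  nearest-neighbour SINGLET BOND-PAIR condensation in the sector ground-state average:
  `c·L⁴ ≤ Re ω₀^{sec}(Δ_d†Δ_d) + Re ω₀^{sec}(Δ_{s*}†Δ_{s*})`, `Δ_{s*} = pairField extendedSWave L`
  (the `A₁g ⊕ B₁g` bond sector; by the parallelogram law this is `Re ω₀^{sec}(Δ_x†Δ_x + Δ_y†Δ_y)` up
  to a factor 2, `Δ_x, Δ_y` the `x`- and `y`-bond singlet fields). In the dictionary: Villain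
  coupling `β_eff = ρ` large and vortex LOOPS as the only defects of the (2+1)D dual height/gauge
  model ⇒ energy–entropy (Peierls) bound ⇒ the spin-wave phase has TRUE long-range order at `T = 0`
  in `d = 2` (no Mermin–Wagner obstruction at zero temperature: `∫ d²k dω (ω² + c²k²)⁻¹ < ∞`).
  Theorem-in-kind for the classical engine: Guth 1980 (4D `U(1)`), Fröhlich–Spencer 1982 (massless
  phases of abelian spin systems / Villain and `XY` in `d ≥ 3` order at large β, RP-free).
  OPEN for fermions: it is the route's rank-2 content (PairCurrentRepresentation + the class theorem
  of dilute-vortex positive current models) with the stiffness as INPUT instead of output; nearest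
  typed relative: FluxSpectroscopy.FluxBridge (stiffness ⇒ Yang ODLRO eigenpairs of EVERY ground
  state at ONE `(U,δ)`; here: window-uniform, ground-state AVERAGE, bond-pair form — neither implies
  the other). Why it might fail: stiffness ≠ condensation in general (quasi-1D Gunther–Imry /
  sliding Luttinger phases: designed out by the `O(1)`, `d = 2`-scaled stiffness on the full range
  `|θ| ≤ π/2`), and a `B₂g` (`d_{xy}`) or `A₂g` condensate has NO nearest-neighbour bond component —
  believed only for densities `n < 0.6`, i.e. outside `δ < 1/4` (Raghu–Kivelson–Scalapino 2010).
* **(S3) `stub_b1gChannelSelection` — CHANNEL SELECTION (`B₁g` beats `A₁g` on the bond sector).**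
  For all data `δ ∈ (0,1/4)`, `0 < U₁ < U₂`, `c > 0`, `L₀`: bond-pair condensation on the window
  (the body of S2's conclusion) forces `d_{x²-y²}` condensation on some open sub-window:
  `c'·L⁴ ≤ Re ω₀^{sec}(Δ_d†Δ_d)`. The Hubbard-specific sign question the engine cannot see (the
  radial/duality part is channel-blind): for the REPULSIVE model the on-site/extended-`s` amplitude
  is suppressed by `U` and every weak-coupling (Kohn–Luttinger / RG) and strong-coupling (`t–J`)
  analysis selects `B₁g` for `n > 3/4`; a theorem nowhere. Why it might fail: an `A₁g` (extended-`s`)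
  window of the pure model at `δ < 1/4` would void it — contrary to consensus, unproved either way.

* **Glue `Thesis_of : S1 → S2 → S3 → Thesis`** (sorry-free, below): take `δ`, the window, `ρ`, `L₀`
  from S1; S2 shrinks the window and yields `c, L₁`; S3 shrinks again and yields `c', L₂`; the
  witness of `Thesis` is `(δ, U₁'', U₂'', c', L₂)` with `0 < U₁ ≤ U₁' ≤ U₁''` and `δ < 1/4 < 1/2`.
  The seam is logic (flag `trivial_seam` expected); all content sits in the three named stubs, none
  of which is bookkeeping: S1 = the superconducting window (Hubbard-specific, XL), S2 = the RP-free
  abelian engine pulled back to fermions (the route's mechanism, XL), S3 = pairing-symmetry selection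
  (L).

Honours: no `Disproof.lean` exists for this crux (`ledger crux ls stmt-HubbardSuperconductivity-1634`:
no files, 2026-08-17), so no `_false_without_` obstruction is on record; `ledger negatives --problem
HubbardSuperconductivity` (2 entries: CooperPairDMottWalk breathing self-duality 1180, AposterioriCapRg
KLS-order openness 1314) — neither concerns flux envelopes, sector ground-state averages or pair
fields, and no stub is an instance of either. The proved support `ThermalToGroundAverage`
(`SectorDWaveBKTBound → Thesis`, the route's T > 0 line) is deliberately NOT used as a stub: a line
`SectorDWaveBKTBound ↦ Thesis` would be one stub implying the crux by a landed theorem (shredding).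
BC3 probes (registrar folder `bc/`): `Sᵢ → Thesis` and `Sᵢ → HubbardSuperconductivity` for
`i = 1, 2, 3` by `first | exact? | simpa | aesop` all FAIL (NOTES.md of the registrar session).

Layout (A12 skeleton audit shape): §1 the three stub STATEMENTS as reducible `Prop` abbreviations
`Statement.stub_<name>` (obligation nodes BY NAME — the admissible hypotheses of `Thesis_of`; no
gate-reserved attribute is used in this workfile); §2 the three sorried stubs `stub_<name>`, each stated
with its signature WRITTEN OUT verbatim (= the text registered on the crux, self-contained over tree
vocabulary, so a prover can restate it in a Theorems file without importing this workfile); §3 the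
composition `Thesis_of : Statement.stub_groundStateStiffness → Statement.stub_stiffnessToBondCondensation →
Statement.stub_b1gChannelSelection → Thesis` (sorry-free; the literal written-out form is re-checked by an
`example`), and `Thesis_of_stubs : Thesis` from the three stubs by name.

Sources: ByersYang1961; ScalapinoWhiteZhang1993 (§II: `D_s` from the flux envelope); Sewell1990
(ODLRO ⇒ flux quantisation, the converse direction of S2); Guth1980; FrohlichSpencerCMP1982;
RaghuKivelsonScalapino2010 (channel vs density at weak coupling); Scalapino1995 §2 (order
functional, form factors); KLS1988PRL (LRO of symmetric finite-volume ground states); QinEtAl2020.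
No definition is introduced.
-/

noncomputable section

-- the summit namespace repeats the problem name by design (D-0017)
set_option linter.dupNamespace false

namespace Summit.HubbardSuperconductivity.HubbardSuperconductivity.Cruxes.Thesis.Birth

open scoped BigOperators Topology Classical Matrix ComplexConjugate
open Filter Set Function
open Literature.Probability.LatticeModels Literature.MathematicalPhysics.QuantumLattice
open Summit.HubbardSuperconductivity.HubbardSuperconductivity.Theses.AbelianDuality

/-! ### §1 The three stub statements (obligation nodes by name; verbatim the signatures of §2) -/

namespace Statement

/-- Statement of stub (S1) `stub_groundStateStiffness` — GROUND-STATE PAIR STIFFNESS ON A WINDOW; see the docstring of `stub_groundStateStiffness` in §2 for the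
reading, plausibility and failure modes. Reducible, so `Thesis_of` and `Thesis_of_stubs` see through it.
[folklore] -/
abbrev stub_groundStateStiffness : Prop :=
    ∃ δ ∈ Set.Ioo (0:ℝ) (1/4), ∃ U₁ U₂ : ℝ, 0 < U₁ ∧ U₁ < U₂ ∧ ∃ ρ : ℝ, 0 < ρ ∧ ∃ L₀ : ℕ,
      ∀ U ∈ Set.Ioo U₁ U₂, ∀ (L : ℕ) [NeZero L], L₀ ≤ L → Even L →
        ∀ θ : ℝ, |θ| ≤ Real.pi / 2 →
          ρ * θ ^ 2 ≤ fluxEnergy L U δ θ - fluxEnergy L U δ 0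

/-- Statement of stub (S2) `stub_stiffnessToBondCondensation` — THE ABELIAN ENGINE AT `T = 0` (stiffness ⇒ bond-pair condensation on a sub-window); see the docstring of `stub_stiffnessToBondCondensation` in §2 for the
reading, plausibility and failure modes. Reducible, so `Thesis_of` and `Thesis_of_stubs` see through it.
[folklore] -/
abbrev stub_stiffnessToBondCondensation : Prop :=
    ∀ δ ∈ Set.Ioo (0:ℝ) (1/4), ∀ (U₁ U₂ ρ : ℝ) (L₀ : ℕ), 0 < U₁ → U₁ < U₂ → 0 < ρ →
      (∀ U ∈ Set.Ioo U₁ U₂, ∀ (L : ℕ) [NeZero L], L₀ ≤ L → Even L →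
        ∀ θ : ℝ, |θ| ≤ Real.pi / 2 →
          ρ * θ ^ 2 ≤ fluxEnergy L U δ θ - fluxEnergy L U δ 0) →
      ∃ U₁' U₂' : ℝ, U₁ ≤ U₁' ∧ U₁' < U₂' ∧ U₂' ≤ U₂ ∧ ∃ c : ℝ, 0 < c ∧ ∃ L₁ : ℕ,
        ∀ U ∈ Set.Ioo U₁' U₂', ∀ (L : ℕ) [NeZero L], L₁ ≤ L → Even L →
          let p : Finset (Orb (FermionTorus 2 L)) → Prop := fun s =>
            s.card = 2 * ⌊(1 - δ) * (L : ℝ) ^ 2 / 2⌋₊ ∧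
              2 * (s.filter fun i => (ofLex i).2 = 0).card = 2 * ⌊(1 - δ) * (L : ℝ) ^ 2 / 2⌋₊;
          c * (L : ℝ) ^ 4 ≤
            (((hubbardTorus 2 L 1 U).toBlock p p).groundStateFunctional
                (((pairField dWaveFormFactor L)ᴴ * pairField dWaveFormFactor L).toBlock p p)).re +
              (((hubbardTorus 2 L 1 U).toBlock p p).groundStateFunctional
                (((pairField extendedSWave L)ᴴ * pairField extendedSWave L).toBlock p p)).re

/-- Statement of stub (S3) `stub_b1gChannelSelection` — CHANNEL SELECTION (`B₁g` over `A₁g` on the bond sector); see the docstring of `stub_b1gChannelSelection` in §2 for the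
reading, plausibility and failure modes. Reducible, so `Thesis_of` and `Thesis_of_stubs` see through it.
[folklore] -/
abbrev stub_b1gChannelSelection : Prop :=
    ∀ δ ∈ Set.Ioo (0:ℝ) (1/4), ∀ (U₁ U₂ c : ℝ) (L₀ : ℕ), 0 < U₁ → U₁ < U₂ → 0 < c →
      (∀ U ∈ Set.Ioo U₁ U₂, ∀ (L : ℕ) [NeZero L], L₀ ≤ L → Even L →
        let p : Finset (Orb (FermionTorus 2 L)) → Prop := fun s =>
          s.card = 2 * ⌊(1 - δ) * (L : ℝ) ^ 2 / 2⌋₊ ∧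
            2 * (s.filter fun i => (ofLex i).2 = 0).card = 2 * ⌊(1 - δ) * (L : ℝ) ^ 2 / 2⌋₊;
        c * (L : ℝ) ^ 4 ≤
          (((hubbardTorus 2 L 1 U).toBlock p p).groundStateFunctional
              (((pairField dWaveFormFactor L)ᴴ * pairField dWaveFormFactor L).toBlock p p)).re +
            (((hubbardTorus 2 L 1 U).toBlock p p).groundStateFunctional
              (((pairField extendedSWave L)ᴴ * pairField extendedSWave L).toBlock p p)).re) →
      ∃ U₁' U₂' : ℝ, U₁ ≤ U₁' ∧ U₁' < U₂' ∧ U₂' ≤ U₂ ∧ ∃ c' : ℝ, 0 < c' ∧ ∃ L₁ : ℕ,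
        ∀ U ∈ Set.Ioo U₁' U₂', ∀ (L : ℕ) [NeZero L], L₁ ≤ L → Even L →
          let p : Finset (Orb (FermionTorus 2 L)) → Prop := fun s =>
            s.card = 2 * ⌊(1 - δ) * (L : ℝ) ^ 2 / 2⌋₊ ∧
              2 * (s.filter fun i => (ofLex i).2 = 0).card = 2 * ⌊(1 - δ) * (L : ℝ) ^ 2 / 2⌋₊;
          c' * (L : ℝ) ^ 4 ≤
            (((hubbardTorus 2 L 1 U).toBlock p p).groundStateFunctional
              (((pairField dWaveFormFactor L)ᴴ * pairField dWaveFormFactor L).toBlock p p)).re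

end Statement

/-! ### §2 The three stubs (sorried; signatures written out = the registered text) -/

/-- **Stub (S1) `stub_groundStateStiffness`** — GROUND-STATE PAIR STIFFNESS ON A WINDOW:
`∃ δ ∈ (0,1/4), 0 < U₁ < U₂, ρ > 0, L₀, ∀ U ∈ (U₁,U₂), ∀ even L ≥ L₀, ∀ |θ| ≤ π/2:
ρ θ² ≤ fluxEnergy L U δ θ - fluxEnergy L U δ 0` — the Byers–Yang / Scalapino–White–Zhang flux
envelope of the `(N_L, S^z = 0)` sector rises quadratically up to half a pair flux quantum, with an
`L`-independent (`d = 2` scale-invariant) stiffness, uniformly on an open coupling window. OPEN (the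
Meissner stiffness of the pure repulsive Hubbard model). [cite: ScalapinoWhiteZhang1993, §II (D_s from the flux envelope)] -/
theorem stub_groundStateStiffness :
    ∃ δ ∈ Set.Ioo (0:ℝ) (1/4), ∃ U₁ U₂ : ℝ, 0 < U₁ ∧ U₁ < U₂ ∧ ∃ ρ : ℝ, 0 < ρ ∧ ∃ L₀ : ℕ,
      ∀ U ∈ Set.Ioo U₁ U₂, ∀ (L : ℕ) [NeZero L], L₀ ≤ L → Even L →
        ∀ θ : ℝ, |θ| ≤ Real.pi / 2 →
          ρ * θ ^ 2 ≤ fluxEnergy L U δ θ - fluxEnergy L U δ 0 := by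
  sorry

/-- **Stub (S2) `stub_stiffnessToBondCondensation`** — THE ABELIAN ENGINE AT `T = 0`: for all
`δ ∈ (0,1/4)`, `0 < U₁ < U₂`, `ρ > 0`, `L₀`, window-uniform ground-state pair stiffness (the body of
S1) forces nearest-neighbour singlet bond-pair condensation of the sector ground-state AVERAGE on an
open sub-window: `∃ U₁ ≤ U₁' < U₂' ≤ U₂, c > 0, L₁, ∀ U ∈ (U₁',U₂'), ∀ even L ≥ L₁:
c·L⁴ ≤ Re ω₀^{sec}(Δ_d†Δ_d) + Re ω₀^{sec}(Δ_{s*}†Δ_{s*})` (`A₁g ⊕ B₁g` bond sector). Dictionary: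
stiffness = Villain `β_eff`, vortex loops = the defects of the (2+1)D dual model, Peierls ⇒ order
(a theorem-in-kind for Villain/`XY` in `d ≥ 3`: Fröhlich–Spencer 1982, Guth 1980); OPEN for fermions.
[cite: FrohlichSpencerCMP1982, spin-system sections (massless/ordered phase of the Villain model at large β)] -/
theorem stub_stiffnessToBondCondensation :
    ∀ δ ∈ Set.Ioo (0:ℝ) (1/4), ∀ (U₁ U₂ ρ : ℝ) (L₀ : ℕ), 0 < U₁ → U₁ < U₂ → 0 < ρ →
      (∀ U ∈ Set.Ioo U₁ U₂, ∀ (L : ℕ) [NeZero L], L₀ ≤ L → Even L →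
        ∀ θ : ℝ, |θ| ≤ Real.pi / 2 →
          ρ * θ ^ 2 ≤ fluxEnergy L U δ θ - fluxEnergy L U δ 0) →
      ∃ U₁' U₂' : ℝ, U₁ ≤ U₁' ∧ U₁' < U₂' ∧ U₂' ≤ U₂ ∧ ∃ c : ℝ, 0 < c ∧ ∃ L₁ : ℕ,
        ∀ U ∈ Set.Ioo U₁' U₂', ∀ (L : ℕ) [NeZero L], L₁ ≤ L → Even L →
          let p : Finset (Orb (FermionTorus 2 L)) → Prop := fun s =>
            s.card = 2 * ⌊(1 - δ) * (L : ℝ) ^ 2 / 2⌋₊ ∧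
              2 * (s.filter fun i => (ofLex i).2 = 0).card = 2 * ⌊(1 - δ) * (L : ℝ) ^ 2 / 2⌋₊;
          c * (L : ℝ) ^ 4 ≤
            (((hubbardTorus 2 L 1 U).toBlock p p).groundStateFunctional
                (((pairField dWaveFormFactor L)ᴴ * pairField dWaveFormFactor L).toBlock p p)).re +
              (((hubbardTorus 2 L 1 U).toBlock p p).groundStateFunctional
                (((pairField extendedSWave L)ᴴ * pairField extendedSWave L).toBlock p p)).re := by
  sorry

/-- **Stub (S3) `stub_b1gChannelSelection`** — CHANNEL SELECTION (`B₁g` over `A₁g`): for all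
`δ ∈ (0,1/4)`, `0 < U₁ < U₂`, `c > 0`, `L₀`, bond-pair condensation of the sector ground-state average
on the window (the body of S2's conclusion) forces `d_{x²-y²}` condensation on an open sub-window:
`∃ U₁ ≤ U₁' < U₂' ≤ U₂, c' > 0, L₁, ∀ U ∈ (U₁',U₂'), ∀ even L ≥ L₁: c'·L⁴ ≤ Re ω₀^{sec}(Δ_d†Δ_d)`.
The repulsive-`U` sign question (extended-`s` suppressed, `B₁g` selected for `n > 3/4`): consensus of
weak-coupling RG and `t–J` numerics, a theorem nowhere; OPEN.
[cite: RaghuKivelsonScalapino2010, §III (pairing channel versus electron density at weak coupling, t' = 0)] -/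
theorem stub_b1gChannelSelection :
    ∀ δ ∈ Set.Ioo (0:ℝ) (1/4), ∀ (U₁ U₂ c : ℝ) (L₀ : ℕ), 0 < U₁ → U₁ < U₂ → 0 < c →
      (∀ U ∈ Set.Ioo U₁ U₂, ∀ (L : ℕ) [NeZero L], L₀ ≤ L → Even L →
        let p : Finset (Orb (FermionTorus 2 L)) → Prop := fun s =>
          s.card = 2 * ⌊(1 - δ) * (L : ℝ) ^ 2 / 2⌋₊ ∧
            2 * (s.filter fun i => (ofLex i).2 = 0).card = 2 * ⌊(1 - δ) * (L : ℝ) ^ 2 / 2⌋₊;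
        c * (L : ℝ) ^ 4 ≤
          (((hubbardTorus 2 L 1 U).toBlock p p).groundStateFunctional
              (((pairField dWaveFormFactor L)ᴴ * pairField dWaveFormFactor L).toBlock p p)).re +
            (((hubbardTorus 2 L 1 U).toBlock p p).groundStateFunctional
              (((pairField extendedSWave L)ᴴ * pairField extendedSWave L).toBlock p p)).re) →
      ∃ U₁' U₂' : ℝ, U₁ ≤ U₁' ∧ U₁' < U₂' ∧ U₂' ≤ U₂ ∧ ∃ c' : ℝ, 0 < c' ∧ ∃ L₁ : ℕ,
        ∀ U ∈ Set.Ioo U₁' U₂', ∀ (L : ℕ) [NeZero L], L₁ ≤ L → Even L →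
          let p : Finset (Orb (FermionTorus 2 L)) → Prop := fun s =>
            s.card = 2 * ⌊(1 - δ) * (L : ℝ) ^ 2 / 2⌋₊ ∧
              2 * (s.filter fun i => (ofLex i).2 = 0).card = 2 * ⌊(1 - δ) * (L : ℝ) ^ 2 / 2⌋₊;
          c' * (L : ℝ) ^ 4 ≤
            (((hubbardTorus 2 L 1 U).toBlock p p).groundStateFunctional
              (((pairField dWaveFormFactor L)ᴴ * pairField dWaveFormFactor L).toBlock p p)).re := by
  sorry

/-! ### §3 Composition: the crux modulo the three registered stubs -/

/-- **The line closes the crux modulo its stubs**: `Thesis` from the statements of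
`stub_groundStateStiffness` (S1), `stub_stiffnessToBondCondensation` (S2) and
`stub_b1gChannelSelection` (S3). The seam is logic: two window shrinkings (`0 < U₁ ≤ U₁' ≤ U₁''`)
and `δ < 1/4 < 1/2`. [folklore] -/
theorem Thesis_of :
    Statement.stub_groundStateStiffness → Statement.stub_stiffnessToBondCondensation →
      Statement.stub_b1gChannelSelection → Thesis := by
  intro h1 h2 h3
  obtain ⟨δ, hδ, U₁, U₂, hU₁, hU₁₂, ρ, hρ, L₀, hstiff⟩ := h1
  obtain ⟨V₁, V₂, hV₁, hV₁₂, _hV₂, c, hc, L₁, hbond⟩ := h2 δ hδ U₁ U₂ ρ L₀ hU₁ hU₁₂ hρ hstiff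
  have hV₁pos : 0 < V₁ := lt_of_lt_of_le hU₁ hV₁
  obtain ⟨W₁, W₂, hW₁, hW₁₂, _hW₂, c', hc', L₂, hd⟩ :=
    h3 δ hδ V₁ V₂ c L₁ hV₁pos hV₁₂ hc hbond
  have hδ' : δ ∈ Set.Ioo (0:ℝ) (1/2) := ⟨hδ.1, hδ.2.trans (by norm_num)⟩
  refine ⟨δ, hδ', W₁, W₂, lt_of_lt_of_le hV₁pos hW₁, hW₁₂, c', hc', L₂, ?_⟩
  intro U hU L _ hL hEven
  exact hd U hU L hL hEven

/-- The literal form `⟨S1-signature⟩ → ⟨S2-signature⟩ → ⟨S3-signature⟩ → Thesis`, written out and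
kernel-checked against `Thesis_of` (an `example`, so it is not a second named candidate for the audit). -/
example :
    (∃ δ ∈ Set.Ioo (0:ℝ) (1/4), ∃ U₁ U₂ : ℝ, 0 < U₁ ∧ U₁ < U₂ ∧ ∃ ρ : ℝ, 0 < ρ ∧ ∃ L₀ : ℕ,
      ∀ U ∈ Set.Ioo U₁ U₂, ∀ (L : ℕ) [NeZero L], L₀ ≤ L → Even L →
        ∀ θ : ℝ, |θ| ≤ Real.pi / 2 →
          ρ * θ ^ 2 ≤ fluxEnergy L U δ θ - fluxEnergy L U δ 0) →
    (∀ δ ∈ Set.Ioo (0:ℝ) (1/4), ∀ (U₁ U₂ ρ : ℝ) (L₀ : ℕ), 0 < U₁ → U₁ < U₂ → 0 < ρ →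
      (∀ U ∈ Set.Ioo U₁ U₂, ∀ (L : ℕ) [NeZero L], L₀ ≤ L → Even L →
        ∀ θ : ℝ, |θ| ≤ Real.pi / 2 →
          ρ * θ ^ 2 ≤ fluxEnergy L U δ θ - fluxEnergy L U δ 0) →
      ∃ U₁' U₂' : ℝ, U₁ ≤ U₁' ∧ U₁' < U₂' ∧ U₂' ≤ U₂ ∧ ∃ c : ℝ, 0 < c ∧ ∃ L₁ : ℕ,
        ∀ U ∈ Set.Ioo U₁' U₂', ∀ (L : ℕ) [NeZero L], L₁ ≤ L → Even L →
          let p : Finset (Orb (FermionTorus 2 L)) → Prop := fun s =>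
            s.card = 2 * ⌊(1 - δ) * (L : ℝ) ^ 2 / 2⌋₊ ∧
              2 * (s.filter fun i => (ofLex i).2 = 0).card = 2 * ⌊(1 - δ) * (L : ℝ) ^ 2 / 2⌋₊;
          c * (L : ℝ) ^ 4 ≤
            (((hubbardTorus 2 L 1 U).toBlock p p).groundStateFunctional
                (((pairField dWaveFormFactor L)ᴴ * pairField dWaveFormFactor L).toBlock p p)).re +
              (((hubbardTorus 2 L 1 U).toBlock p p).groundStateFunctional
                (((pairField extendedSWave L)ᴴ * pairField extendedSWave L).toBlock p p)).re) →
    (∀ δ ∈ Set.Ioo (0:ℝ) (1/4), ∀ (U₁ U₂ c : ℝ) (L₀ : ℕ), 0 < U₁ → U₁ < U₂ → 0 < c →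
      (∀ U ∈ Set.Ioo U₁ U₂, ∀ (L : ℕ) [NeZero L], L₀ ≤ L → Even L →
        let p : Finset (Orb (FermionTorus 2 L)) → Prop := fun s =>
          s.card = 2 * ⌊(1 - δ) * (L : ℝ) ^ 2 / 2⌋₊ ∧
            2 * (s.filter fun i => (ofLex i).2 = 0).card = 2 * ⌊(1 - δ) * (L : ℝ) ^ 2 / 2⌋₊;
        c * (L : ℝ) ^ 4 ≤
          (((hubbardTorus 2 L 1 U).toBlock p p).groundStateFunctional
              (((pairField dWaveFormFactor L)ᴴ * pairField dWaveFormFactor L).toBlock p p)).re +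
            (((hubbardTorus 2 L 1 U).toBlock p p).groundStateFunctional
              (((pairField extendedSWave L)ᴴ * pairField extendedSWave L).toBlock p p)).re) →
      ∃ U₁' U₂' : ℝ, U₁ ≤ U₁' ∧ U₁' < U₂' ∧ U₂' ≤ U₂ ∧ ∃ c' : ℝ, 0 < c' ∧ ∃ L₁ : ℕ,
        ∀ U ∈ Set.Ioo U₁' U₂', ∀ (L : ℕ) [NeZero L], L₁ ≤ L → Even L →
          let p : Finset (Orb (FermionTorus 2 L)) → Prop := fun s =>
            s.card = 2 * ⌊(1 - δ) * (L : ℝ) ^ 2 / 2⌋₊ ∧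
              2 * (s.filter fun i => (ofLex i).2 = 0).card = 2 * ⌊(1 - δ) * (L : ℝ) ^ 2 / 2⌋₊;
          c' * (L : ℝ) ^ 4 ≤
            (((hubbardTorus 2 L 1 U).toBlock p p).groundStateFunctional
              (((pairField dWaveFormFactor L)ᴴ * pairField dWaveFormFactor L).toBlock p p)).re) →
    Thesis :=
  Thesis_of

/-- The crux from the three stubs BY NAME (registered form `⟨S1, S2, S3⟩ ↦ Thesis`). [folklore] -/
theorem Thesis_of_stubs : Thesis :=
  Thesis_of stub_groundStateStiffness stub_stiffnessToBondCondensation stub_b1gChannelSelection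

end Summit.HubbardSuperconductivity.HubbardSuperconductivity.Cruxes.Thesis.Birth
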